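import Mathlib
import HarnessLib
import Summits.Ventures.LatticeQCDFlow.Exactness.TransformedKernel
import Summits.Ventures.LatticeQCDFlow.Scoring.KernelTransitionOperator
import Summits.Ventures.LatticeQCDFlow.Scoring.CalibrationTruths

/-!
# The transition operator of a field-transformed update is the original operator conjugated by the map: autocovariances, `L²₀` contraction rates and `τ_int` are shared

HONEST FRAMING: exact (Metropolis-corrected) sampling algorithms for lattice gauge theory;
figures of merit are autocorrelation/cost numbers at stated couplings and volumes; no
continuum-physics claim.

Venture `LatticeQCDFlow` (cell pub-lqcd), topic `Exactness`; FANOUT row 7 (`s0-cpn-null`: the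
S0-D1 rung — 2D CP⁹, Lüscher's leading-order trivializing map INSIDE the HMC algorithm ("THMC",
Engel–Schaefer 2011) versus plain HMC; figure of merit `τ_int(Q²)` and its scaling exponent).
NEW WORK of the cell over Mathlib and the tree's own files — `Exactness/TransformedKernel.lean`
(row 7: `conjKernel κ F`, the `V`-update `κ` REPORTED in the variables `U = F V`;
`integral_conjKernel`), `Scoring/KernelTransitionOperator.lean` (row 8: the transition operator on
observables `kop κ g x = ∫ g d(κ x)` and the stationary lag-`t` second moment
`autocov κ π f t = ∫ f · (kop κ)^[t] f dπ`) and `Scoring/CalibrationTruths.lean` (row 11: the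
integrated autocorrelation time `tauInt ρ = 1/2 + Σ_{t ≥ 1} ρ t` and its windowed form
`tauIntWindow ρ W` of an autocorrelation sequence `ρ`).  Nothing here is cited as a fact.  Printed
counterparts, NAMED ONLY: Lüscher 2010 §2 (HMC in the variables `V`, `U = 𝓕(V)`), Engel–Schaefer
2011 §2–§3 (THMC; autocorrelation times of `Q²`, `χ_m`, `ξ_G`, `E` measured on `U = 𝓕(V)`),
Madras–Sokal 1988 / Wolff 2004 (`τ_int`, windowing).

`Exactness/TransformedKernel.lean` proved the observable dictionary in INTEGRAL form
(`correlation_conjKernel_nHit`: `∫ O · (Kⁿ O) d(F_*ν) = ∫ (O∘F) · (κⁿ(O∘F)) dν`).  This file is the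
same dictionary at the level of the TRANSITION OPERATOR of row 8, where the cell's autocorrelation
bounds live (`Scoring/KernelTransitionOperator`, `Exactness/FlowSamplerSpectralGap`: an `L²₀`
contraction `∫ (K g)² dπ ≤ ρ ∫ g² dπ` on centred observables), so that every such bound proved for
the `V`-chain of the modified action is, verbatim and with the same constant, a bound for the
reported `U`-chain — and conversely.

## Content (`κ : Kernel Ω Ω` the `V`-update, `F : Ω ≃ᵐ Ω'` the field transformation, `ν` a law on `Ω`)

* **`kop_conjKernel`** — `kop (conjKernel κ F) g = (kop κ (g ∘ F)) ∘ F⁻¹`: the transition operator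
  of the reported chain is the `V`-chain's operator conjugated by composition with `F` (the
  intertwining `kop_conjKernel_comp : (kop K g) ∘ F = kop κ (g ∘ F)`); `iterate_kop_conjKernel` —
  the same for every power `t` (the `t`-step operators); `kop_conjKernel_eigen` — eigenfunctions
  correspond under `f ↦ f ∘ F⁻¹` with the SAME eigenvalue (relaxation modes and their rates are
  shared).
* **`autocov_conjKernel`** — `autocov (conjKernel κ F) (F_*ν) g t = autocov κ ν (g ∘ F) t` for
  every `t`; with `integral_map_equiv` (`∫ g d(F_*ν) = ∫ g∘F dν`) the whole stationary
  autocovariance FUNCTION of `g` under the reported chain is that of `g ∘ F` under the `V`-chain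
  (`autocov_conjKernel_fun`), hence so is its normalised autocorrelation sequence
  (`acfSeq_conjKernel`, stated for the explicit quotient `(C(t) − m²)/(C(0) − m²)`), and therefore
  **`tauInt_conjKernel`** / `tauIntWindow_conjKernel`: the integrated autocorrelation time of `g`
  in THMC (windowed or not) IS `τ_int` of `g ∘ 𝓕` in the HMC chain for the modified action — the
  tree's `tauInt` / `tauIntWindow` applied to the two sequences give the same number because the
  sequences are equal.
* `integral_sq_conjKernel`, `integral_kop_sq_conjKernel` — `‖g‖²_{L²(F_*ν)} = ‖g∘F‖²_{L²(ν)}` and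
  `‖K g‖²_{L²(F_*ν)} = ‖κ (g∘F)‖²_{L²(ν)}`; **`l2Contraction_conjKernel_iff`** — for every `ρ`,
  "`∫ (K g)² d(F_*ν) ≤ ρ ∫ g² d(F_*ν)` for all bounded measurable `F_*ν`-centred `g`" holds for the
  reported kernel IFF "`∫ (κ f)² dν ≤ ρ ∫ f² dν` for all bounded measurable `ν`-centred `f`" holds
  for `κ`: the `L²₀` contraction modulus (the quantity bounded by `1 − gap`) is an invariant of the
  change of variables.  `l2Contraction_iterate_conjKernel_iff` — the same for the `t`-step
  operators (so geometric `L²` rates `ρ^t` transfer with the same `ρ`).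

Reading for row 7.  THMC and HMC-for-`S̃` are ONE Markov operator in two coordinate systems; a
trivializing map can change an autocorrelation time only through the dynamics of the modified
action `S̃ = S∘𝓕 − log det 𝓕_*` (how fast HMC decorrelates `Q²∘𝓕` under `S̃`), never through the
bookkeeping of where observables are measured.  Nothing quantitative about that dynamics is
claimed here.

NOT CLAIMED: the transition operator as a bounded operator on the Hilbert space `L²(ν)` of
a.e.-classes and the unitary `U_F : L²(F_*ν) → L²(ν)`, `g ↦ g ∘ F` (Mathlib's
`Lp.compMeasurePreservingₗᵢ` would give it; the function-level statements below are what the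
cell's files consume); spectra beyond eigenfunctions; anything about a specific `κ` or `𝓕`.
-/

noncomputable section

namespace Summit.Ventures.LatticeQCDFlow.Exactness

open MeasureTheory ProbabilityTheory Summit.Ventures.LatticeQCDFlow.Scoring

variable {Ω Ω' : Type*} [MeasurableSpace Ω] [MeasurableSpace Ω']

/-! ## The operator dictionary -/

/-- **The reported chain's transition operator is the conjugate of the `V`-chain's**:
`kop (conjKernel κ F) g = (kop κ (g ∘ F)) ∘ F⁻¹`, i.e.
`(K g)(x) = ∫ (g ∘ F) d(κ (F⁻¹ x))`. -/
theorem kop_conjKernel (κ : Kernel Ω Ω) (F : Ω ≃ᵐ Ω') (g : Ω' → ℝ) :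
    kop (conjKernel κ F) g = kop κ (g ∘ F) ∘ F.symm := by
  funext x
  simp only [kop, Function.comp_apply, integral_conjKernel]

/-- The intertwining form: `(kop (conjKernel κ F) g) ∘ F = kop κ (g ∘ F)`. -/
theorem kop_conjKernel_comp (κ : Kernel Ω Ω) (F : Ω ≃ᵐ Ω') (g : Ω' → ℝ) :
    kop (conjKernel κ F) g ∘ F = kop κ (g ∘ F) := by
  rw [kop_conjKernel]
  funext v
  simp only [Function.comp_apply, MeasurableEquiv.symm_apply_apply]

/-- Pointwise: `kop (conjKernel κ F) g (F v) = kop κ (g ∘ F) v`. -/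
theorem kop_conjKernel_apply (κ : Kernel Ω Ω) (F : Ω ≃ᵐ Ω') (g : Ω' → ℝ) (v : Ω) :
    kop (conjKernel κ F) g (F v) = kop κ (g ∘ F) v := by
  rw [kop_conjKernel]
  simp only [Function.comp_apply, MeasurableEquiv.symm_apply_apply]

/-- **Every power**: `(kop (conjKernel κ F))^[t] g = ((kop κ)^[t] (g ∘ F)) ∘ F⁻¹` — the `t`-step
operators are conjugate too. -/
theorem iterate_kop_conjKernel (κ : Kernel Ω Ω) (F : Ω ≃ᵐ Ω') :
    ∀ (t : ℕ) (g : Ω' → ℝ), (kop (conjKernel κ F))^[t] g = (kop κ)^[t] (g ∘ F) ∘ F.symm := by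
  intro t
  induction t with
  | zero =>
    intro g
    funext x
    simp only [Function.iterate_zero, id_eq, Function.comp_apply, MeasurableEquiv.apply_symm_apply]
  | succ t ih =>
    intro g
    have hX : (kop κ (g ∘ F) ∘ F.symm) ∘ F = kop κ (g ∘ F) := by
      funext v
      simp only [Function.comp_apply, MeasurableEquiv.symm_apply_apply]
    rw [Function.iterate_succ_apply, Function.iterate_succ_apply, ih, kop_conjKernel, hX]

/-- Pointwise form of `iterate_kop_conjKernel`: `(Kᵗ g)(F v) = (κᵗ (g∘F))(v)`. -/
theorem iterate_kop_conjKernel_apply (κ : Kernel Ω Ω) (F : Ω ≃ᵐ Ω') (t : ℕ) (g : Ω' → ℝ)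
    (v : Ω) : (kop (conjKernel κ F))^[t] g (F v) = (kop κ)^[t] (g ∘ F) v := by
  rw [iterate_kop_conjKernel]
  simp only [Function.comp_apply, MeasurableEquiv.symm_apply_apply]

/-- **Eigenfunctions correspond with the same eigenvalue**: if `kop κ f = λ f` then
`kop (conjKernel κ F) (f ∘ F⁻¹) = λ (f ∘ F⁻¹)` (relaxation modes of the `V`-chain, read through the
map, are relaxation modes of the reported chain with the same rate). -/
theorem kop_conjKernel_eigen (κ : Kernel Ω Ω) (F : Ω ≃ᵐ Ω') {f : Ω → ℝ} {lam : ℝ}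
    (h : kop κ f = fun v => lam * f v) :
    kop (conjKernel κ F) (f ∘ F.symm) = fun x => lam * (f ∘ F.symm) x := by
  rw [kop_conjKernel]
  have hfF : (f ∘ F.symm) ∘ F = f := by
    funext v
    simp only [Function.comp_apply, MeasurableEquiv.symm_apply_apply]
  rw [hfF, h]
  rfl

/-- … and conversely: an eigenfunction `g` of the reported operator gives the eigenfunction
`g ∘ F` of `kop κ` with the same eigenvalue. -/
theorem kop_eigen_of_conjKernel (κ : Kernel Ω Ω) (F : Ω ≃ᵐ Ω') {g : Ω' → ℝ} {lam : ℝ}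
    (h : kop (conjKernel κ F) g = fun x => lam * g x) :
    kop κ (g ∘ F) = fun v => lam * (g ∘ F) v := by
  rw [← kop_conjKernel_comp, h]
  funext v
  simp only [Function.comp_apply]

/-! ## Autocovariances and integrated autocorrelation times are shared -/

/-- **Stationary autocovariances transfer**: `autocov (conjKernel κ F) (F_*ν) g t =
autocov κ ν (g ∘ F) t` — the lag-`t` second moment `E[g(U₀) g(U_t)]` of the reported chain started
from `F_*ν` is `E[(g∘F)(V₀) (g∘F)(V_t)]` of the `V`-chain started from `ν`. -/
theorem autocov_conjKernel (κ : Kernel Ω Ω) (F : Ω ≃ᵐ Ω') (ν : Measure Ω) (g : Ω' → ℝ) (t : ℕ) :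
    autocov (conjKernel κ F) (ν.map F) g t = autocov κ ν (g ∘ F) t := by
  unfold autocov
  rw [integral_map_equiv]
  refine integral_congr_ae (Filter.Eventually.of_forall fun v => ?_)
  simp only [iterate_kop_conjKernel_apply, Function.comp_apply]

/-- The whole autocovariance FUNCTION is shared. -/
theorem autocov_conjKernel_fun (κ : Kernel Ω Ω) (F : Ω ≃ᵐ Ω') (ν : Measure Ω) (g : Ω' → ℝ) :
    autocov (conjKernel κ F) (ν.map F) g = autocov κ ν (g ∘ F) :=
  funext (autocov_conjKernel κ F ν g)

/-- Means transfer (Mathlib's `integral_map_equiv`, recorded in the dictionary's notation):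
`∫ g d(F_*ν) = ∫ (g ∘ F) dν`. -/
theorem mean_conjKernel (F : Ω ≃ᵐ Ω') (ν : Measure Ω) (g : Ω' → ℝ) :
    ∫ x, g x ∂(ν.map F) = ∫ v, (g ∘ F) v ∂ν := by
  rw [integral_map_equiv]
  rfl

/-- **The normalised autocorrelation sequence is shared**: with `m = ∫ g d(F_*ν) = ∫ g∘F dν` and
`C(t)` the lag-`t` second moment, `ρ(t) = (C(t) − m²)/(C(0) − m²)` is the same sequence for `g`
under the reported chain and for `g ∘ F` under the `V`-chain. -/
theorem acfSeq_conjKernel (κ : Kernel Ω Ω) (F : Ω ≃ᵐ Ω') (ν : Measure Ω) (g : Ω' → ℝ) :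
    (fun t => (autocov (conjKernel κ F) (ν.map F) g t - (∫ x, g x ∂(ν.map F)) ^ 2) /
        (autocov (conjKernel κ F) (ν.map F) g 0 - (∫ x, g x ∂(ν.map F)) ^ 2)) =
      fun t => (autocov κ ν (g ∘ F) t - (∫ v, (g ∘ F) v ∂ν) ^ 2) /
        (autocov κ ν (g ∘ F) 0 - (∫ v, (g ∘ F) v ∂ν) ^ 2) := by
  funext t
  rw [autocov_conjKernel, autocov_conjKernel, mean_conjKernel]

/-- **`τ_int` is shared.**  The tree's integrated autocorrelation time
(`Scoring.tauInt ρ = 1/2 + Σ_{t≥1} ρ t`, `Scoring/CalibrationTruths.lean`) of the normalised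
autocorrelation sequence of `g` under the reported chain equals that of `g ∘ F` under the
`V`-chain: "τ_int(Q²) of THMC" is, by a theorem and not by convention, τ_int of `Q² ∘ 𝓕` in the
HMC chain for the modified action. -/
theorem tauInt_conjKernel (κ : Kernel Ω Ω) (F : Ω ≃ᵐ Ω') (ν : Measure Ω) (g : Ω' → ℝ) :
    tauInt (fun t => (autocov (conjKernel κ F) (ν.map F) g t - (∫ x, g x ∂(ν.map F)) ^ 2) /
        (autocov (conjKernel κ F) (ν.map F) g 0 - (∫ x, g x ∂(ν.map F)) ^ 2)) =
      tauInt (fun t => (autocov κ ν (g ∘ F) t - (∫ v, (g ∘ F) v ∂ν) ^ 2) /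
        (autocov κ ν (g ∘ F) 0 - (∫ v, (g ∘ F) v ∂ν) ^ 2)) := by
  rw [acfSeq_conjKernel]

/-- … and so is every WINDOWED `τ_int` (`Scoring.tauIntWindow ρ W = 1/2 + Σ_{t=1}^{W} ρ t`, the
Γ-method's estimand at window `W`). -/
theorem tauIntWindow_conjKernel (κ : Kernel Ω Ω) (F : Ω ≃ᵐ Ω') (ν : Measure Ω) (g : Ω' → ℝ)
    (W : ℕ) :
    tauIntWindow (fun t => (autocov (conjKernel κ F) (ν.map F) g t - (∫ x, g x ∂(ν.map F)) ^ 2) /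
        (autocov (conjKernel κ F) (ν.map F) g 0 - (∫ x, g x ∂(ν.map F)) ^ 2)) W =
      tauIntWindow (fun t => (autocov κ ν (g ∘ F) t - (∫ v, (g ∘ F) v ∂ν) ^ 2) /
        (autocov κ ν (g ∘ F) 0 - (∫ v, (g ∘ F) v ∂ν) ^ 2)) W := by
  rw [acfSeq_conjKernel]

/-! ## `L²` norms and the `L²₀` contraction modulus are shared -/

/-- `‖g‖²_{L²(F_*ν)} = ‖g ∘ F‖²_{L²(ν)}`. -/
theorem integral_sq_conjKernel (F : Ω ≃ᵐ Ω') (ν : Measure Ω) (g : Ω' → ℝ) :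
    ∫ x, g x ^ 2 ∂(ν.map F) = ∫ v, (g ∘ F) v ^ 2 ∂ν := by
  rw [integral_map_equiv]
  rfl

/-- `‖K g‖²_{L²(F_*ν)} = ‖κ (g ∘ F)‖²_{L²(ν)}` for `K = kop (conjKernel κ F)`. -/
theorem integral_kop_sq_conjKernel (κ : Kernel Ω Ω) (F : Ω ≃ᵐ Ω') (ν : Measure Ω) (g : Ω' → ℝ) :
    ∫ x, kop (conjKernel κ F) g x ^ 2 ∂(ν.map F) = ∫ v, kop κ (g ∘ F) v ^ 2 ∂ν := by
  rw [integral_map_equiv]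
  refine integral_congr_ae (Filter.Eventually.of_forall fun v => ?_)
  simp only [kop_conjKernel_apply]

/-- The same for the `t`-step operators. -/
theorem integral_iterate_kop_sq_conjKernel (κ : Kernel Ω Ω) (F : Ω ≃ᵐ Ω') (ν : Measure Ω)
    (g : Ω' → ℝ) (t : ℕ) :
    ∫ x, (kop (conjKernel κ F))^[t] g x ^ 2 ∂(ν.map F) = ∫ v, (kop κ)^[t] (g ∘ F) v ^ 2 ∂ν := by
  rw [integral_map_equiv]
  refine integral_congr_ae (Filter.Eventually.of_forall fun v => ?_)
  simp only [iterate_kop_conjKernel_apply]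

/-- **The `L²₀` contraction modulus is an invariant of the change of variables.**  For every
`ρ`: the reported kernel contracts every bounded measurable `F_*ν`-centred observable in
`L²(F_*ν)` by `ρ` (in mean square) IFF `κ` contracts every bounded measurable `ν`-centred
observable in `L²(ν)` by `ρ`.  (`g ↔ g ∘ F` is a bijection between the two classes of test
observables preserving centring, bounds, measurability and both sides of the inequality.) -/
theorem l2Contraction_conjKernel_iff (κ : Kernel Ω Ω) (F : Ω ≃ᵐ Ω') (ν : Measure Ω) (ρ : ℝ) :
    (∀ g : Ω' → ℝ, Measurable g → (∃ C, ∀ x, |g x| ≤ C) → ∫ x, g x ∂(ν.map F) = 0 →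
        ∫ x, kop (conjKernel κ F) g x ^ 2 ∂(ν.map F) ≤ ρ * ∫ x, g x ^ 2 ∂(ν.map F)) ↔
      (∀ f : Ω → ℝ, Measurable f → (∃ C, ∀ v, |f v| ≤ C) → ∫ v, f v ∂ν = 0 →
        ∫ v, kop κ f v ^ 2 ∂ν ≤ ρ * ∫ v, f v ^ 2 ∂ν) := by
  constructor
  · intro h f hf hb hf0
    obtain ⟨C, hC⟩ := hb
    have hg : Measurable (f ∘ F.symm) := hf.comp F.symm.measurable
    have hgb : ∃ C, ∀ x, |(f ∘ F.symm) x| ≤ C := ⟨C, fun x => hC _⟩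
    have hfF : (f ∘ F.symm) ∘ F = f := by
      funext v
      simp only [Function.comp_apply, MeasurableEquiv.symm_apply_apply]
    have hg0 : ∫ x, (f ∘ F.symm) x ∂(ν.map F) = 0 := by
      rw [mean_conjKernel, hfF, hf0]
    have key := h (f ∘ F.symm) hg hgb hg0
    rwa [integral_kop_sq_conjKernel, integral_sq_conjKernel, hfF] at key
  · intro h g hg hb hg0
    obtain ⟨C, hC⟩ := hb
    have hf : Measurable (g ∘ F) := hg.comp F.measurable
    have hfb : ∃ C, ∀ v, |(g ∘ F) v| ≤ C := ⟨C, fun v => hC _⟩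
    have hf0 : ∫ v, (g ∘ F) v ∂ν = 0 := by rw [← mean_conjKernel, hg0]
    rw [integral_kop_sq_conjKernel, integral_sq_conjKernel]
    exact h (g ∘ F) hf hfb hf0

/-- The same equivalence for the `t`-step operators: a mean-square bound
`∫ (Kᵗ g)² ≤ ρ_t ∫ g²` on centred observables holds for the reported kernel iff it holds for `κ`
(so a geometric `L²` rate `ρ_t = ρ^{2t}` — the spectral-gap form used in
`Exactness/FlowSamplerSpectralGap.lean` — transfers with the same `ρ`). -/
theorem l2Contraction_iterate_conjKernel_iff (κ : Kernel Ω Ω) (F : Ω ≃ᵐ Ω') (ν : Measure Ω)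
    (ρ : ℝ) (t : ℕ) :
    (∀ g : Ω' → ℝ, Measurable g → (∃ C, ∀ x, |g x| ≤ C) → ∫ x, g x ∂(ν.map F) = 0 →
        ∫ x, (kop (conjKernel κ F))^[t] g x ^ 2 ∂(ν.map F) ≤ ρ * ∫ x, g x ^ 2 ∂(ν.map F)) ↔
      (∀ f : Ω → ℝ, Measurable f → (∃ C, ∀ v, |f v| ≤ C) → ∫ v, f v ∂ν = 0 →
        ∫ v, (kop κ)^[t] f v ^ 2 ∂ν ≤ ρ * ∫ v, f v ^ 2 ∂ν) := by
  constructor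
  · intro h f hf hb hf0
    obtain ⟨C, hC⟩ := hb
    have hg : Measurable (f ∘ F.symm) := hf.comp F.symm.measurable
    have hgb : ∃ C, ∀ x, |(f ∘ F.symm) x| ≤ C := ⟨C, fun x => hC _⟩
    have hfF : (f ∘ F.symm) ∘ F = f := by
      funext v
      simp only [Function.comp_apply, MeasurableEquiv.symm_apply_apply]
    have hg0 : ∫ x, (f ∘ F.symm) x ∂(ν.map F) = 0 := by
      rw [mean_conjKernel, hfF, hf0]
    have key := h (f ∘ F.symm) hg hgb hg0
    rwa [integral_iterate_kop_sq_conjKernel, integral_sq_conjKernel, hfF] at key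
  · intro h g hg hb hg0
    obtain ⟨C, hC⟩ := hb
    have hf : Measurable (g ∘ F) := hg.comp F.measurable
    have hfb : ∃ C, ∀ v, |(g ∘ F) v| ≤ C := ⟨C, fun v => hC _⟩
    have hf0 : ∫ v, (g ∘ F) v ∂ν = 0 := by rw [← mean_conjKernel, hg0]
    rw [integral_iterate_kop_sq_conjKernel, integral_sq_conjKernel]
    exact h (g ∘ F) hf hfb hf0

/-- **Autocovariance bounds transfer verbatim.**  Any bound on the centred autocovariances of the
`V`-chain that is uniform over a class of observables closed under `g ↦ g ∘ F` — here: all bounded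
measurable centred ones, with an envelope `B` depending on the observable only through its bound
`C` and its variance — holds for the reported chain with the same envelope. -/
theorem autocov_bound_conjKernel (κ : Kernel Ω Ω) (F : Ω ≃ᵐ Ω') (ν : Measure Ω)
    (B : ℝ → ℝ → ℕ → ℝ)
    (h : ∀ f : Ω → ℝ, Measurable f → ∀ C, (∀ v, |f v| ≤ C) → ∫ v, f v ∂ν = 0 →
      ∀ t, |autocov κ ν f t| ≤ B C (∫ v, f v ^ 2 ∂ν) t)
    {g : Ω' → ℝ} (hg : Measurable g) {C : ℝ} (hC : ∀ x, |g x| ≤ C)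
    (hg0 : ∫ x, g x ∂(ν.map F) = 0) (t : ℕ) :
    |autocov (conjKernel κ F) (ν.map F) g t| ≤ B C (∫ x, g x ^ 2 ∂(ν.map F)) t := by
  have hf0 : ∫ v, (g ∘ F) v ∂ν = 0 := by rw [← mean_conjKernel, hg0]
  rw [autocov_conjKernel, integral_sq_conjKernel]
  exact h (g ∘ F) (hg.comp F.measurable) C (fun v => hC _) hf0 t

end Summit.Ventures.LatticeQCDFlow.Exactness

end
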